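import Summits.BirchSwinnertonDyer.Rank1Residual.X2.IsogenyLambdaInvariant
import Summits.BirchSwinnertonDyer.BirchSwinnertonDyer.Theorems.EisensteinPrimesSplitMultSfTransfer
import HarnessLib

/-!
# `λ(X_ac^S(E/K_∞))` — the `λ`-invariant of the dual of Castella's anticyclotomic Selmer group — is a `K`-ISOGENY INVARIANT
# (crux 4 `BSDpOnCellC`, stmt-BirchSwinnertonDyer-19034, line b1 v12; cell `bsd-eis`, width seat `bsd-line-x2-p2` gen 11; skeleton of
# record UNCHANGED, W-79)

WHY. The wall `stub_imprimitiveCount` (conj. 2, split `p ‖ N`) bounds `m + Σ_{w∈Sf} λ(𝒫_w(f))` by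
`λ(X_ac^{Sf}(E_K[p^∞]))` — the `λ`-invariant of `AcSelmer.XAc (W.baseChange K) p κ 𝔭bar Sf γ`. This seat's lineage proved the count for
the curves at Keller–Yin's normalised lattice (every rational `p`-line ramified at `p`, p679932), and gen 11 proved that EVERY split X2c
curve is `ℚ`-isogenous to such a curve ([NORM], p681574 `IsogenyNormalisation.exists_isIsogenous_forall_not_lineUnramifiedAt`). To carry
the count from the normalised member back to an ARBITRARY member of the class (the road that composes with the V11 chain, which consumes the
count at the Manin-optimal member — see p681931's docstring) one needs Greenberg–Vatsal's sentence "the `λ`-invariant is always unchanged by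
an isogeny" (GV 2000 p. 28) for `X_ac^S`. The tree has it for the classical `Sel_{p^∞}(E/K_∞)` (`X2.IsogenyLambdaInvariant`); this file
proves it for Castella's `Sel_𝔭^S(K_∞, E[p^∞])` and its `Λ`-dual `X_ac^S` (`Castella2018.AcSelmer`, the Literature copy used by the b1 chain), for ANY number field `K`, ANY
`ℤ_p`-extension `κ`, any `𝔭`, `S`, `γ`:

  `lambdaInvariant_xAc_eq_of_isogeny` — `φ : Isogeny W W'` (curves over `K`) ⟹
  `lambdaInvariant p (XAc W p κ 𝔭 S γ) = lambdaInvariant p (XAc W' p κ 𝔭 S γ)`.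

METHOD (that of `X2/IsogenySelmerInfty` + `X2/IsogenyLambdaInvariant`, transposed to Castella's local conditions):
* §1 `H¹(K_∞, φ)` (`X2.IsogenySelmerInfty.h1Map`) RESPECTS CASTELLA'S CONDITIONS — they are all kernels of restriction-type maps
  `resH1Hom`: locally trivial at the finite `w ∉ S`, `w ∤ p` (`awayKer`) and at infinity (`infKer`), strict for `M⁺_𝔭 = 0` at `𝔭`
  (`strictDatum`, `strictKer`) — by naturality of `resH1Hom` (`resH1Hom_comp`); so it maps `Sel_𝔭^S(K_∞, E[p^∞])` into
  `Sel_𝔭^S(K_∞, E'[p^∞])` (`h1Map_mem_selmerAc`), and `Sel(ψ) ∘ Sel(φ) = deg φ` for the dual isogeny (`h1Map_h1Map_of_comp_eq_nsmul`);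
* §2 precomposition `X_ac^S(E') → X_ac^S(E)` is `Λ`-LINEAR: the `Λ = ℤ_p⟦T⟧`-action is the truncated sum
  `Σ_{i<N} f_i · x((conj_γ − 1)^i s)` (`IwasawaDual.evalT`) on both sides and `Sel(φ)` intertwines `conj_γ` (`h1Map_conjH1`) — the argument
  of p675080 `SplitMultSfTransfer.smul_apply_inclusion_eq` with the inclusion replaced by `Sel(φ)`;
* §3 two `Λ`-linear maps `X' ⇄ X` with both composites `= deg φ` give `ℚ_p ⊗_{ℤ_p} X ≅ ℚ_p ⊗_{ℤ_p} X'`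
  (`X2.IsogenyLambdaInvariant.finrank_baseChange_eq_of_quasiInverse`), i.e. equal `λ` (the tree's `lambdaInvariant = dim_{ℚ_p} ℚ_p ⊗_{ℤ_p} X`).
  No finiteness / torsion / `μ` hypothesis (`μ` CAN change under a `p`-isogeny — Schneider; not touched).

HONEST FRAMING: helper theorems only (0 defs, 0 named facts introduced, 0 sorry); UNCONDITIONAL; closes no stub; no summit statement / BSD /
MC / IMC is proved for any curve; 0 cells / labels / tiers move.

References: [GreenbergVatsal2000] §2 p. 28 ("The λ-invariant is always unchanged by an isogeny"); [Castella2018] Def. 2.1–2.2, §2.2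
(arXiv:1704.06608 p. 5); [GreenbergLNM1716] §1; [SilvermanAEC2009] III.6.1–6.2; [Washington1997] §13.2; cell files `X2/IsogenySelmerInfty`,
`X2/IsogenyLambdaInvariant` (b2b-bsdres), Literature `Castella2018/AnticyclotomicSelmer{,Dual}`, p675080 `…SplitMultSfTransfer` (g10).
-/

set_option autoImplicit false
set_option linter.dupNamespace false -- the summit namespace `…BirchSwinnertonDyer.BirchSwinnertonDyer.Theorems` (Sub = Summit, D-0017) trips it

noncomputable section

open scoped Classical TensorProduct

universe u

namespace Summit.BirchSwinnertonDyer.BirchSwinnertonDyer.Theorems.XAcIsogenyInvariance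

open WeierstrassCurve NumberField IsDedekindDomain Field PowerSeries
open Literature.NumberTheory.EllipticCurves Literature.NumberTheory.EllipticCurves.GreenbergSelmer
  Literature.NumberTheory.GaloisRepresentations Literature.NumberTheory.EllipticCurves.IwasawaAlgebra
  Literature.NumberTheory.EllipticCurves.Castella2018 Summit.BirchSwinnertonDyer.Rank1Residual.X2

variable {K : Type} [Field K] [NumberField K] {W W' : WeierstrassCurve K} (p : ℕ) [hp : Fact p.Prime]

/-! ## §1 `H¹(K_∞, φ)` respects Castella's local conditions -/

section Conditions

variable (H : Subgroup (absoluteGaloisGroup K)) (f : W.geomPoints →+ W'.geomPoints)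
  (hf : ∀ (σ : absoluteGaloisGroup K) (P : W.geomPoints), f (σ • P) = σ • f P)

omit hp in
/-- **`H¹(H, f)` respects `awayKer`** (the class is locally trivial at the chosen place above `v`): restriction to `H ⊓ D_v` commutes with
the change of coefficients `f|E[p^∞]` (both composites are `resH1Hom` of the pair `(H ⊓ D_v ↪ H, f|E[p^∞])`). [cite: Castella2018, Def. 2.2 (arXiv:1704.06608 p. 5)] -/
theorem h1Map_mem_awayKer (v : HeightOneSpectrum (𝓞 K)) {c : W.subgroupH1 p H}
    (hc : c ∈ awayKer H (geomPrimaryTorsion W p) v) :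
    IsogenySelmerInfty.h1Map p H f hf c ∈ awayKer H (geomPrimaryTorsion W' p) v := by
  have hf' : ∀ (x : ↥(H ⊓ decomp (K := K) v)) (m : geomPrimaryTorsion W p),
      IsogenySelmerInfty.primaryTorsionMap p f (ContinuousMonoidHom.id _ x • m) = x • IsogenySelmerInfty.primaryTorsionMap p f m :=
    IsogenySelmerInfty.primaryTorsionMap_smul_subgroup p (H ⊓ decomp (K := K) v) f hf
  have key : (Literature.NumberTheory.EllipticCurves.resOfLe (geomPrimaryTorsion W' p)
        (inf_le_left : H ⊓ decomp (K := K) v ≤ H)).comp (IsogenySelmerInfty.h1Map p H f hf) =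
      (resH1Hom (ContinuousMonoidHom.id _) (IsogenySelmerInfty.primaryTorsionMap p f) hf').comp
        (Literature.NumberTheory.EllipticCurves.resOfLe (geomPrimaryTorsion W p)
          (inf_le_left : H ⊓ decomp (K := K) v ≤ H)) := by
    unfold IsogenySelmerInfty.h1Map Literature.NumberTheory.EllipticCurves.resOfLe
    erw [resH1Hom_comp, resH1Hom_comp]
    exact resH1Hom_congr (by ext; rfl) (by ext; rfl) _ _
  change _ ∈ (Literature.NumberTheory.EllipticCurves.resOfLe (geomPrimaryTorsion W' p) _).ker
  change _ ∈ (Literature.NumberTheory.EllipticCurves.resOfLe (geomPrimaryTorsion W p) _).ker at hc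
  rw [AddMonoidHom.mem_ker] at hc ⊢
  have hkey := congrArg (fun F : W.subgroupH1 p H →+ _ ↦ F c) key
  simp only [AddMonoidHom.comp_apply] at hkey
  rw [hkey, hc, map_zero]

omit [NumberField K] hp in
/-- **`H¹(H, f)` respects `infKer`** (the condition at an infinite place `w`): same naturality with `H ⊓ D_w`.
[cite: Castella2018, Def. 2.2 (arXiv:1704.06608 p. 5)] -/
theorem h1Map_mem_infKer (w : InfinitePlace K) {c : W.subgroupH1 p H}
    (hc : c ∈ infKer H (geomPrimaryTorsion W p) w) :
    IsogenySelmerInfty.h1Map p H f hf c ∈ infKer H (geomPrimaryTorsion W' p) w := by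
  have hf' : ∀ (x : ↥(H ⊓ decompInf (K := K) w)) (m : geomPrimaryTorsion W p),
      IsogenySelmerInfty.primaryTorsionMap p f (ContinuousMonoidHom.id _ x • m) = x • IsogenySelmerInfty.primaryTorsionMap p f m :=
    IsogenySelmerInfty.primaryTorsionMap_smul_subgroup p (H ⊓ decompInf (K := K) w) f hf
  have key : (Literature.NumberTheory.EllipticCurves.resOfLe (geomPrimaryTorsion W' p)
        (inf_le_left : H ⊓ decompInf (K := K) w ≤ H)).comp (IsogenySelmerInfty.h1Map p H f hf) =
      (resH1Hom (ContinuousMonoidHom.id _) (IsogenySelmerInfty.primaryTorsionMap p f) hf').comp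
        (Literature.NumberTheory.EllipticCurves.resOfLe (geomPrimaryTorsion W p)
          (inf_le_left : H ⊓ decompInf (K := K) w ≤ H)) := by
    unfold IsogenySelmerInfty.h1Map Literature.NumberTheory.EllipticCurves.resOfLe
    erw [resH1Hom_comp, resH1Hom_comp]
    exact resH1Hom_congr (by ext; rfl) (by ext; rfl) _ _
  change _ ∈ (Literature.NumberTheory.EllipticCurves.resOfLe (geomPrimaryTorsion W' p) _).ker
  change _ ∈ (Literature.NumberTheory.EllipticCurves.resOfLe (geomPrimaryTorsion W p) _).ker at hc
  rw [AddMonoidHom.mem_ker] at hc ⊢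
  have hkey := congrArg (fun F : W.subgroupH1 p H →+ _ ↦ F c) key
  simp only [AddMonoidHom.comp_apply] at hkey
  rw [hkey, hc, map_zero]

omit hp in
/-- **`H¹(H, f)` respects the STRICT condition for `M⁺_𝔭 = 0`** (the class dies in `H¹(H ⊓ D_𝔭, E[p^∞] ⧸ 0)`): the map induced by `f` on the
quotients `E[p^∞] ⧸ 0 → E'[p^∞] ⧸ 0` (`QuotientAddGroup.map`) is `D_𝔭`-equivariant and intertwines the two strict maps.
[cite: Castella2018, §2.1 Def. 2.1–2.2 (arXiv:1704.06608 p. 5)] [cite: Greenberg1989, §1 p. 98] -/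
theorem h1Map_mem_strictKer (𝔭 : HeightOneSpectrum (𝓞 K)) {c : W.subgroupH1 p H}
    (hc : c ∈ (AcSelmer.strictDatum (geomPrimaryTorsion W p) 𝔭).strictKer H) :
    IsogenySelmerInfty.h1Map p H f hf c ∈ (AcSelmer.strictDatum (geomPrimaryTorsion W' p) 𝔭).strictKer H := by
  set N := AcSelmer.strictDatum (geomPrimaryTorsion W p) 𝔭 with hN
  set N' := AcSelmer.strictDatum (geomPrimaryTorsion W' p) 𝔭 with hN'
  -- the induced map on the graded pieces `M ⧸ 0 → M' ⧸ 0`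
  let g : N.Gr →+ N'.Gr := QuotientAddGroup.map N.plus N'.plus (IsogenySelmerInfty.primaryTorsionMap p f) fun m hm ↦ by
    change m ∈ (⊥ : AddSubgroup (geomPrimaryTorsion W p)) at hm
    rw [AddSubgroup.mem_bot] at hm
    subst hm
    rw [AddSubgroup.mem_comap, map_zero]
    exact AddSubgroup.zero_mem _
  have hg : ∀ m : geomPrimaryTorsion W p, g (N.grMk m) = N'.grMk (IsogenySelmerInfty.primaryTorsionMap p f m) := fun _ ↦ rfl
  have hg' : ∀ (x : decompIn H 𝔭) (q : N.Gr), g (ContinuousMonoidHom.id _ x • q) = x • g q := by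
    intro x q
    obtain ⟨m, rfl⟩ := N.grMk_surjective q
    change g (N.grMk ((((x : decomp (K := K) 𝔭)) : absoluteGaloisGroup K) • m)) =
      N'.grMk ((((x : decomp (K := K) 𝔭)) : absoluteGaloisGroup K) • IsogenySelmerInfty.primaryTorsionMap p f m)
    rw [hg, IsogenySelmerInfty.primaryTorsionMap_smul p f hf]
  have key : (N'.strictMap H).comp (IsogenySelmerInfty.h1Map p H f hf) =
      (resH1Hom (ContinuousMonoidHom.id _) g hg').comp (N.strictMap H) := by
    unfold IsogenySelmerInfty.h1Map LocalDatum.strictMap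
    erw [resH1Hom_comp, resH1Hom_comp]
    exact resH1Hom_congr (by ext; rfl) (by ext; rfl) _ _
  rw [LocalDatum.mem_strictKer_iff] at hc ⊢
  have hkey := congrArg (fun F : W.subgroupH1 p H →+ _ ↦ F c) key
  simp only [AddMonoidHom.comp_apply] at hkey
  rw [hkey, hc, map_zero]

variable [H.Normal]

omit hp in
/-- **`H¹(H, f)` maps `Sel_𝔭^S(L, E[p^∞])` into `Sel_𝔭^S(L, E'[p^∞])`** (`L = K̄^H`): Castella's three conditions, at every conjugate (all
places of `L`), are respected (§1 lemmas + `h1Map_conjH1`). [cite: Castella2018, Def. 2.2 (arXiv:1704.06608 p. 5)] -/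
theorem h1Map_mem_selmerOver {𝔭 : HeightOneSpectrum (𝓞 K)} {S : Set (HeightOneSpectrum (𝓞 K))}
    {c : W.subgroupH1 p H} (hc : c ∈ AcSelmer.selmerOver H (geomPrimaryTorsion W p) p 𝔭 S) :
    IsogenySelmerInfty.h1Map p H f hf c ∈ AcSelmer.selmerOver H (geomPrimaryTorsion W' p) p 𝔭 S := by
  rw [AcSelmer.mem_selmerOver_iff] at hc ⊢
  have e : ∀ σ : absoluteGaloisGroup K,
      IsogenySelmerInfty.h1Map p H f hf (conjH1 H (geomPrimaryTorsion W p) σ c) =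
        conjH1 H (geomPrimaryTorsion W' p) σ (IsogenySelmerInfty.h1Map p H f hf c) :=
    fun σ ↦ IsogenySelmerInfty.h1Map_conjH1 p H f hf σ c
  refine ⟨fun v hv hvS σ ↦ ?_, fun w σ ↦ ?_, fun σ ↦ ?_⟩
  · have h := h1Map_mem_awayKer p H f hf v (hc.1 v hv hvS σ)
    rw [e] at h
    exact h
  · have h := h1Map_mem_infKer p H f hf w (hc.2.1 w σ)
    rw [e] at h
    exact h
  · have h := h1Map_mem_strictKer p H f hf 𝔭 (hc.2.2 σ)
    rw [e] at h
    exact h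

/-- `H¹(K_∞, f)` maps `Sel_𝔭^S(K_∞, E[p^∞])` into `Sel_𝔭^S(K_∞, E'[p^∞])` (the curve-level abbreviation `AcSelmer.selmerAc`).
[cite: Castella2018, Def. 2.2 (arXiv:1704.06608 p. 5)] -/
theorem h1Map_mem_selmerAc (κ : ZpExtension K p) {𝔭 : HeightOneSpectrum (𝓞 K)}
    {S : Set (HeightOneSpectrum (𝓞 K))} {c : W.subgroupH1 p κ.kerSubgroup} (hc : c ∈ AcSelmer.selmerAc W p κ 𝔭 S) :
    IsogenySelmerInfty.h1Map p κ.kerSubgroup f hf c ∈ AcSelmer.selmerAc W' p κ 𝔭 S :=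
  h1Map_mem_selmerOver p κ.kerSubgroup f hf hc

end Conditions

/-! ## §2 `Sel(φ)` on Castella's Selmer groups and the `Λ`-linear precomposition on the duals -/

section Selmer

variable (κ : ZpExtension K p) (𝔭 : HeightOneSpectrum (𝓞 K)) (S : Set (HeightOneSpectrum (𝓞 K)))

/-- **`Sel(φ) : Sel_𝔭^S(K_∞, E[p^∞]) → Sel_𝔭^S(K_∞, E'[p^∞])`** for a `Γ_K`-equivariant `f : E(K̄) → E'(K̄)` (e.g. a `K`-isogeny): the
restriction of `H¹(K_∞, f)`, packaged existentially (no definition introduced; values recorded through the coercion to `H¹`).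
[cite: Castella2018, Def. 2.2 (arXiv:1704.06608 p. 5)] [cite: GreenbergVatsal2000, §2 p. 28] -/
theorem exists_selmerAcMap (f : W.geomPoints →+ W'.geomPoints)
    (hf : ∀ (σ : absoluteGaloisGroup K) (P : W.geomPoints), f (σ • P) = σ • f P) :
    ∃ α : AcSelmer.selmerAc W p κ 𝔭 S →+ AcSelmer.selmerAc W' p κ 𝔭 S,
      ∀ s, ((α s : AcSelmer.selmerAc W' p κ 𝔭 S) : W'.subgroupH1 p κ.kerSubgroup) =
        IsogenySelmerInfty.h1Map p κ.kerSubgroup f hf (s : W.subgroupH1 p κ.kerSubgroup) :=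
  ⟨((IsogenySelmerInfty.h1Map p κ.kerSubgroup f hf).comp (AcSelmer.selmerAc W p κ 𝔭 S).subtype).codRestrict
      (AcSelmer.selmerAc W' p κ 𝔭 S) fun s ↦ h1Map_mem_selmerAc p f hf κ s.2,
    fun _ ↦ rfl⟩

variable {κ 𝔭 S}

/-- `Sel(φ)` intertwines the powers of `conj_γ − 1` (`h1Map_conjH1`). [cite: Castella2018, §2.1–2.2 (arXiv:1704.06608 p. 5)] -/
theorem conjSub_pow_selmerAcMap {f : W.geomPoints →+ W'.geomPoints}
    {hf : ∀ (σ : absoluteGaloisGroup K) (P : W.geomPoints), f (σ • P) = σ • f P}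
    {α : AcSelmer.selmerAc W p κ 𝔭 S →+ AcSelmer.selmerAc W' p κ 𝔭 S}
    (hα : ∀ s, ((α s : AcSelmer.selmerAc W' p κ 𝔭 S) : W'.subgroupH1 p κ.kerSubgroup) =
      IsogenySelmerInfty.h1Map p κ.kerSubgroup f hf (s : W.subgroupH1 p κ.kerSubgroup))
    (γ : absoluteGaloisGroup K) (i : ℕ) (s : AcSelmer.selmerAc W p κ 𝔭 S) :
    ((AcSelmer.conjSelmerAc W' p κ 𝔭 S γ - 1) ^ i) (α s) = α (((AcSelmer.conjSelmerAc W p κ 𝔭 S γ - 1) ^ i) s) := by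
  have hψ : ∀ t, (AcSelmer.conjSelmerAc W' p κ 𝔭 S γ - 1) (α t) = α ((AcSelmer.conjSelmerAc W p κ 𝔭 S γ - 1) t) := by
    intro t
    apply Subtype.ext
    simp only [IwasawaDual.End_sub_apply, AddMonoid.End.one_apply, map_sub, AddSubgroupClass.coe_sub,
      AcSelmer.coe_conjSelmerAc_apply, hα]
    rw [IsogenySelmerInfty.h1Map_conjH1]
  induction i generalizing s with
  | zero => rw [pow_zero, pow_zero, AddMonoid.End.one_apply, AddMonoid.End.one_apply]
  | succ i ih =>
    rw [pow_succ, pow_succ, AddMonoid.End.coe_mul, AddMonoid.End.coe_mul, Function.comp_apply, Function.comp_apply, hψ, ih]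

variable (γ : absoluteGaloisGroup K) [hγ : Fact (κ.IsTopGenerator γ)]

/-- **Precomposition with `Sel(φ)` is `Λ`-linear** (pointwise form): for `y = x' ∘ Sel(φ)`, `(f • x')(Sel(φ) s) = (f • y)(s)` — on both
sides the action of `f ∈ Λ = ℤ_p⟦T⟧` is the truncated sum `Σ_{i<N} f_i · x'((conj_γ − 1)^i ·)` (`IwasawaDual.evalT`), and `Sel(φ)` intertwines
the two operators `conj_γ − 1` (`conjSub_pow_selmerAcMap`); the argument of p675080 `SplitMultSfTransfer.smul_apply_inclusion_eq`.
[cite: Castella2018, §2.2 (arXiv:1704.06608 p. 5)] [cite: GreenbergLNM1716, §1 (after Conj. 1.3)] -/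
theorem smul_apply_selmerAcMap_eq {f₀ : W.geomPoints →+ W'.geomPoints}
    {hf₀ : ∀ (σ : absoluteGaloisGroup K) (P : W.geomPoints), f₀ (σ • P) = σ • f₀ P}
    {α : AcSelmer.selmerAc W p κ 𝔭 S →+ AcSelmer.selmerAc W' p κ 𝔭 S}
    (hα : ∀ s, ((α s : AcSelmer.selmerAc W' p κ 𝔭 S) : W'.subgroupH1 p κ.kerSubgroup) =
      IsogenySelmerInfty.h1Map p κ.kerSubgroup f₀ hf₀ (s : W.subgroupH1 p κ.kerSubgroup))
    (f : IwasawaAlgebra p) (x' : AcSelmer.XAc W' p κ 𝔭 S γ) (y : AcSelmer.XAc W p κ 𝔭 S γ)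
    (hy : ∀ t, y t = x' (α t)) (s : AcSelmer.selmerAc W p κ 𝔭 S) :
    (f • x') (α s) = (f • y) s := by
  have h' : IwasawaDual.IsLocNil p (AcSelmer.conjSelmerAc W' p κ 𝔭 S γ - 1) :=
    AcSelmer.isLocNil_conjSelmerAc_sub_one W' p κ 𝔭 S hγ.out
  have h : IwasawaDual.IsLocNil p (AcSelmer.conjSelmerAc W p κ 𝔭 S γ - 1) :=
    AcSelmer.isLocNil_conjSelmerAc_sub_one W p κ 𝔭 S hγ.out
  obtain ⟨N, hN⟩ := h.nil s
  obtain ⟨k, hk⟩ := h.torsion s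
  have hN' : ((AcSelmer.conjSelmerAc W' p κ 𝔭 S γ - 1) ^ N) (α s) = 0 := by
    rw [conjSub_pow_selmerAcMap p hα, hN, map_zero]
  have hk' : p ^ k • α s = 0 := by rw [← map_nsmul, hk, map_zero]
  rw [SplitMultSfTransfer.xAc_smul_apply, SplitMultSfTransfer.xAc_smul_apply, h'.smulFun_apply f _ hN' hk',
    h.smulFun_apply f _ hN hk, IwasawaDual.evalT_def, IwasawaDual.evalT_def]
  refine Finset.sum_congr rfl fun i _ ↦ ?_
  rw [conjSub_pow_selmerAcMap p hα]
  exact congrArg (fun z ↦ IwasawaDual.zpT p k (PowerSeries.coeff i f) z) (hy _).symm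

/-- **The `Λ`-linear precomposition `Sel(φ)^∨ : X_ac^S(E') → X_ac^S(E)`**, `x' ↦ x' ∘ Sel(φ)`, packaged existentially with its values
(no definition introduced). [cite: Castella2018, §2.2 (arXiv:1704.06608 p. 5)] [cite: GreenbergVatsal2000, §2 p. 28] -/
theorem exists_linearMap_xAc {f₀ : W.geomPoints →+ W'.geomPoints}
    {hf₀ : ∀ (σ : absoluteGaloisGroup K) (P : W.geomPoints), f₀ (σ • P) = σ • f₀ P}
    {α : AcSelmer.selmerAc W p κ 𝔭 S →+ AcSelmer.selmerAc W' p κ 𝔭 S}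
    (hα : ∀ s, ((α s : AcSelmer.selmerAc W' p κ 𝔭 S) : W'.subgroupH1 p κ.kerSubgroup) =
      IsogenySelmerInfty.h1Map p κ.kerSubgroup f₀ hf₀ (s : W.subgroupH1 p κ.kerSubgroup)) :
    ∃ F : AcSelmer.XAc W' p κ 𝔭 S γ →ₗ[IwasawaAlgebra p] AcSelmer.XAc W p κ 𝔭 S γ,
      ∀ (x' : AcSelmer.XAc W' p κ 𝔭 S γ) (s : AcSelmer.selmerAc W p κ 𝔭 S), F x' s = x' (α s) := by
  -- the underlying function: `x' ↦ (s ↦ x' (α s))`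
  let F₀ : AcSelmer.XAc W' p κ 𝔭 S γ → AcSelmer.XAc W p κ 𝔭 S γ := fun x' ↦
    show AcSelmer.selmerAc W p κ 𝔭 S →+ AddCircle (1 : ℚ) from
      AddMonoidHom.mk' (fun s ↦ x' (α s)) fun s t ↦ by rw [map_add, map_add]
  have hF₀ : ∀ (x' : AcSelmer.XAc W' p κ 𝔭 S γ) (s : AcSelmer.selmerAc W p κ 𝔭 S), F₀ x' s = x' (α s) :=
    fun _ _ ↦ rfl
  refine ⟨{ toFun := F₀
            map_add' := fun x' y' ↦ DFunLike.ext _ _ fun s ↦ ?_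
            map_smul' := fun f x' ↦ DFunLike.ext _ _ fun s ↦ ?_ }, hF₀⟩
  · show F₀ (x' + y') s = (F₀ x' + F₀ y') s
    rw [hF₀]
    rfl
  · show F₀ (f • x') s = (f • F₀ x') s
    rw [hF₀]
    exact smul_apply_selmerAcMap_eq p γ hα f x' (F₀ x') (hF₀ x') s

end Selmer

/-! ## §3 The theorem -/

section Main

variable {p} (κ : ZpExtension K p) (𝔭 : HeightOneSpectrum (𝓞 K)) (S : Set (HeightOneSpectrum (𝓞 K)))
  (γ : absoluteGaloisGroup K) [hγ : Fact (κ.IsTopGenerator γ)] [W.IsElliptic] [W'.IsElliptic]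

/-- **`λ(X_ac^S(E[p^∞])) = λ(X_ac^S(E'[p^∞]))` for `K`-isogenous elliptic curves** ("The `λ`-invariant is always unchanged by an
isogeny", Greenberg–Vatsal 2000 p. 28 — here for the dual of Castella's anticyclotomic Selmer group `Sel_𝔭^S(K_∞, ·)`, any number field
`K`, any `ℤ_p`-extension `κ`, any `𝔭`, `S`, `γ`). Proof: `Sel(φ)` and `Sel(ψ)` for the dual isogeny `ψ` (`ψ ∘ φ = [deg φ]`,
`φ ∘ ψ = [deg φ]`, Silverman III.6.1–6.2) dualise to `Λ`-linear maps `X' ⇄ X` with both composites multiplication by `deg φ` (§2), so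
`ℚ_p ⊗_{ℤ_p} X ≅ ℚ_p ⊗_{ℤ_p} X'` (`X2.IsogenyLambdaInvariant.finrank_baseChange_eq_of_quasiInverse`) and the tree's
`lambdaInvariant = dim_{ℚ_p}(ℚ_p ⊗_{ℤ_p} X)` agree. No cotorsion / finiteness / `μ` hypothesis.
[cite: GreenbergVatsal2000, §2 p. 28 ("The λ-invariant is always unchanged by an isogeny")] [cite: Castella2018, Def. 2.2 and §2.2 (arXiv:1704.06608 p. 5)]
[cite: SilvermanAEC2009, Thm. III.6.1(a) and III.6.2] -/
theorem lambdaInvariant_xAc_eq_of_isogeny (φ : Isogeny W W') :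
    lambdaInvariant p (AcSelmer.XAc W p κ 𝔭 S γ) = lambdaInvariant p (AcSelmer.XAc W' p κ 𝔭 S γ) := by
  obtain ⟨ψ, hψ⟩ := φ.exists_dual_of_isElliptic
  set n : ℕ := φ.degree with hn
  have hn0 : n ≠ 0 := φ.degree_pos.ne'
  have hφψ : ∀ Q : W'.geomPoints, φ (ψ Q) = (n : ℤ) • Q := by
    intro Q
    obtain ⟨P, rfl⟩ := φ.surjective Q
    rw [hψ, map_zsmul]
  -- the Selmer maps and their composites
  obtain ⟨α, hα⟩ := exists_selmerAcMap p κ 𝔭 S φ.toAddMonoidHom φ.equivariant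
  obtain ⟨β, hβ⟩ := exists_selmerAcMap p κ 𝔭 S ψ.toAddMonoidHom ψ.equivariant
  have hβα : ∀ s, β (α s) = n • s := fun s ↦ by
    apply Subtype.ext
    rw [hβ, hα, AddSubgroupClass.coe_nsmul]
    exact IsogenySelmerInfty.h1Map_h1Map_of_comp_eq_nsmul p κ.kerSubgroup φ.toAddMonoidHom φ.equivariant ψ.toAddMonoidHom
      ψ.equivariant (fun P ↦ hψ P) _
  have hαβ : ∀ s', α (β s') = n • s' := fun s' ↦ by
    apply Subtype.ext
    rw [hα, hβ, AddSubgroupClass.coe_nsmul]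
    exact IsogenySelmerInfty.h1Map_h1Map_of_comp_eq_nsmul p κ.kerSubgroup ψ.toAddMonoidHom ψ.equivariant φ.toAddMonoidHom
      φ.equivariant (fun Q ↦ hφψ Q) _
  -- the `Λ`-linear duals `F = Sel(φ)^∨ : X' → X`, `G = Sel(ψ)^∨ : X → X'`
  obtain ⟨F, hF⟩ := exists_linearMap_xAc p γ hα
  obtain ⟨G, hG⟩ := exists_linearMap_xAc p γ hβ
  have hFG : ∀ x : AcSelmer.XAc W p κ 𝔭 S γ, F (G x) = (n : IwasawaAlgebra p) • x := fun x ↦ by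
    refine DFunLike.ext _ _ fun s ↦ ?_
    rw [hF, hG, hβα, map_nsmul, Nat.cast_smul_eq_nsmul]
    rfl
  have hGF : ∀ x' : AcSelmer.XAc W' p κ 𝔭 S γ, G (F x') = (n : IwasawaAlgebra p) • x' := fun x' ↦ by
    refine DFunLike.ext _ _ fun s' ↦ ?_
    rw [hG, hF, hαβ, map_nsmul, Nat.cast_smul_eq_nsmul]
    rfl
  -- restriction of scalars to `ℤ_p` (as in the definition of `lambdaInvariant`)
  letI iX : Module ℤ_[p] (AcSelmer.XAc W p κ 𝔭 S γ) :=
    Module.compHom (AcSelmer.XAc W p κ 𝔭 S γ) (algebraMap ℤ_[p] (IwasawaAlgebra p))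
  letI iX' : Module ℤ_[p] (AcSelmer.XAc W' p κ 𝔭 S γ) :=
    Module.compHom (AcSelmer.XAc W' p κ 𝔭 S γ) (algebraMap ℤ_[p] (IwasawaAlgebra p))
  let F' : AcSelmer.XAc W' p κ 𝔭 S γ →ₗ[ℤ_[p]] AcSelmer.XAc W p κ 𝔭 S γ :=
    { toFun := F
      map_add' := F.map_add
      map_smul' := fun c x' ↦ by
        change F (algebraMap ℤ_[p] (IwasawaAlgebra p) c • x') = algebraMap ℤ_[p] (IwasawaAlgebra p) c • F x'
        exact F.map_smul _ _ }
  let G' : AcSelmer.XAc W p κ 𝔭 S γ →ₗ[ℤ_[p]] AcSelmer.XAc W' p κ 𝔭 S γ :=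
    { toFun := G
      map_add' := G.map_add
      map_smul' := fun c x ↦ by
        change G (algebraMap ℤ_[p] (IwasawaAlgebra p) c • x) = algebraMap ℤ_[p] (IwasawaAlgebra p) c • G x
        exact G.map_smul _ _ }
  have hFG' : F'.comp G' = (n : ℤ_[p]) • LinearMap.id := by
    ext x
    change F (G x) = algebraMap ℤ_[p] (IwasawaAlgebra p) (n : ℤ_[p]) • x
    rw [hFG x, map_natCast]
  have hGF' : G'.comp F' = (n : ℤ_[p]) • LinearMap.id := by
    ext x'
    change G (F x') = algebraMap ℤ_[p] (IwasawaAlgebra p) (n : ℤ_[p]) • x'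
    rw [hGF x', map_natCast]
  have hunit : IsUnit (algebraMap ℤ_[p] ℚ_[p] (n : ℤ_[p])) := by
    rw [map_natCast, isUnit_iff_ne_zero]
    exact_mod_cast hn0
  have key := IsogenyLambdaInvariant.finrank_baseChange_eq_of_quasiInverse ℚ_[p] F' G' (n : ℤ_[p]) hunit hFG' hGF'
  change Module.finrank ℚ_[p] (ℚ_[p] ⊗[ℤ_[p]] AcSelmer.XAc W p κ 𝔭 S γ) =
    Module.finrank ℚ_[p] (ℚ_[p] ⊗[ℤ_[p]] AcSelmer.XAc W' p κ 𝔭 S γ)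
  exact key

/-- `IsIsogenous` form. [cite: GreenbergVatsal2000, §2 p. 28] -/
theorem lambdaInvariant_xAc_eq_of_isIsogenous (h : IsIsogenous W W') :
    lambdaInvariant p (AcSelmer.XAc W p κ 𝔭 S γ) = lambdaInvariant p (AcSelmer.XAc W' p κ 𝔭 S γ) :=
  h.elim fun φ ↦ lambdaInvariant_xAc_eq_of_isogeny κ 𝔭 S γ φ

end Main

end Summit.BirchSwinnertonDyer.BirchSwinnertonDyer.Theorems.XAcIsogenyInvariance

end
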